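import Summits.Ventures.Crystal3D.Theorems.StickyWulffConstantTextureBuildFrameAgreement
import Summits.Ventures.Crystal3D.Theorems.StickyWulffConstantGenericWallFloorFramePropagation
import Summits.Ventures.Crystal3D.Theorems.StickyWulffConstantCoaxialWallLawFrame
import HarnessLib

/-!
# The RISER PACKAGE (B6), part 2: (L-ax) «TWO LAYERINGS ⇒ PARALLEL AXES OR FCC», and the SHARED AXIS of the two column grains' class frames
# (lane T, crux `TextureLiminfV5`, stmt-Ventures-23912; design memo HOME/wulff-p2/g21/B6-DESIGN-g21.md §4; ruling (ccxi)(D) «(L-ax) is a lemma»)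

HONEST FRAMING. Venture `Summits/Ventures/Crystal3D` (cell `crystal3d-full`), route `route-Ventures-StickyWulffConstant`, helper `--supports` the
law-v5 crux `TextureLiminfV5` (stmt-Ventures-23912).  Pure lattice geometry of Barlow stackings (census-free, standard axioms); nothing about any cover or
mesh is proved; F-C1 not moved.

WHY.  Inside a riser box the two column grains `f, g` are presented in ONE riser frame `L₀` (`Mesh₃.hframe`: `S f = stacking L₀ s₀ σL`, `S g = stacking L₀ s₀ σR`,
`rn r = L₀ e₃`), but the texture's law data use the canonical frames of the grains' OWN presentations `(tent f).frame a`.  The horizontal (layer / mid-slab)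
contacts inside the box are free iff `SharedAxis (rn r) ((tent f).frame a) ((tent g).frame b)` — this file proves it:
* `axis_parallel_or_affineFcc` — **two layerings**: if `stacking L s σ = stacking L′ s′ σ′` as point sets, then `L e₃ = ± L′ e₃` or the set is an affine fcc
  lattice (an hcp-type site transports the layer plane: `hcpType_of_shell_transfer`, …GenericWallFloorFramePropagation; a word with no letter change is
  constant: `exists_affine_fcc_of_const`);
* `TentPiece.frame_subset_frameStacking_of_eq` — every class frame of a tent piece whose stacking is an `L₀`-stacking has its lattice inside an `L₀`-stacking
  (parallel case: the slab dictionary of …FrameAgreement identifies the bilayer with an `L₀`-bilayer, then bilayer rigidity; fcc case: `bilayerFrame_image_eq`);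
* **`TentPiece.sharedAxis_of_stacking_eq`** — (L-ax): two tent pieces presented as `L₀`-stackings have class frames sharing the axis `L₀ e₃`.
-/

noncomputable section

open scoped BigOperators InnerProductSpace
open Set

namespace Summit.Ventures.Crystal3D.Cruxes.TextureLiminf.TexShadow

open Summit.Ventures.Crystal3D Summit.Ventures.Crystal3D.Theorems
open Summit.Ventures.Crystal3D.TentCertificate (height hB hB_pos image_fccRef_eq_of_bilayer_subset)
open Literature.MathematicalPhysics.StatisticalMechanics (IsHaggSeq barlowStacking barlowPos fccStacking constHagg isHaggSeq_const triangularVec₁ triangularVec₂)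

/-! ### Words: not constant ⇒ a letter change -/

/-- A word that is not constant changes letter between two consecutive layers. -/
theorem exists_adjacent_ne_of_not_const {σ : ℤ → ℤ} (h : ¬ ∀ k, σ k = σ 0) : ∃ k, σ (k - 1) ≠ σ k := by
  by_contra hne
  push Not at hne
  apply h
  intro k
  induction k using Int.induction_on with
  | zero => rfl
  | succ n ih =>
    have h1 := hne ((n : ℤ) + 1)
    rw [add_sub_cancel_right] at h1
    rw [← h1, ih]
  | pred n ih =>
    have h1 := hne (-(n : ℤ))
    rw [h1, ih]

/-! ### Two layerings -/

/-- Inner product in coordinates. -/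
private theorem inner_three (a b : E3) : ⟪a, b⟫_ℝ = a 0 * b 0 + a 1 * b 1 + a 2 * b 2 := by
  rw [EuclideanSpace.inner_eq_star_dotProduct]
  simp [dotProduct, Fin.sum_univ_three, mul_comm]

/-- Norm squared in coordinates. -/
private theorem norm_sq_three (a : E3) : ‖a‖ ^ 2 = a 0 ^ 2 + a 1 ^ 2 + a 2 ^ 2 := by
  rw [EuclideanSpace.norm_sq_eq, Fin.sum_univ_three]
  simp [Real.norm_eq_abs, sq_abs]

/-- A linear isometry mapping the two in-layer generators `u, v` to horizontal vectors maps `e₃` to `± e₃`. -/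
theorem map_e₃_eq_or_of_horizontal (M : E3 ≃ₗᵢ[ℝ] E3) (hu : (M (triangularVec₁ 1)) 2 = 0) (hv : (M (triangularVec₂ 1)) 2 = 0) :
    M e₃ = e₃ ∨ M e₃ = -e₃ := by
  set a := M (triangularVec₁ 1) with ha
  set b := M (triangularVec₂ 1) with hb
  set c := M e₃ with hc
  -- inner products are preserved
  have h3 : Real.sqrt 3 ^ 2 = 3 := Real.sq_sqrt (by norm_num)
  have hua : ⟪c, a⟫_ℝ = 0 := by
    rw [hc, ha, LinearIsometryEquiv.inner_map_map, inner_three]; simp [e₃, triangularVec₁]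
  have hvb : ⟪c, b⟫_ℝ = 0 := by
    rw [hc, hb, LinearIsometryEquiv.inner_map_map, inner_three]; simp [e₃, triangularVec₂]
  have haa : ‖a‖ ^ 2 = 1 := by rw [ha, LinearIsometryEquiv.norm_map, norm_triangularVec₁_one, one_pow]
  have hbb : ‖b‖ ^ 2 = 1 := by rw [hb, LinearIsometryEquiv.norm_map, norm_triangularVec₂_one, one_pow]
  have hab : ⟪a, b⟫_ℝ = 1 / 2 := by
    rw [ha, hb, LinearIsometryEquiv.inner_map_map, inner_three]; simp [triangularVec₁, triangularVec₂]
  have hcc : ‖c‖ ^ 2 = 1 := by rw [hc, LinearIsometryEquiv.norm_map]; simp [e₃]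
  rw [inner_three] at hua hvb hab
  rw [norm_sq_three] at haa hbb hcc
  have ha2 : a 2 = 0 := hu
  have hb2 : b 2 = 0 := hv
  rw [ha2] at hua haa hab
  rw [hb2] at hvb hbb hab
  -- 2×2 elimination
  have hdet : (a 0 * b 1 - a 1 * b 0) ^ 2 = 3 / 4 := by
    have e : (a 0 * b 1 - a 1 * b 0) ^ 2 = (a 0 ^ 2 + a 1 ^ 2) * (b 0 ^ 2 + b 1 ^ 2) - (a 0 * b 0 + a 1 * b 1) ^ 2 := by ring
    rw [e]; nlinarith
  have hdet0 : a 0 * b 1 - a 1 * b 0 ≠ 0 := by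
    intro h0; rw [h0] at hdet; norm_num at hdet
  have hc0 : c 0 * (a 0 * b 1 - a 1 * b 0) = 0 := by linear_combination (b 1) * hua - (a 1) * hvb
  have hc1 : c 1 * (a 0 * b 1 - a 1 * b 0) = 0 := by linear_combination (a 0) * hvb - (b 0) * hua
  have hc0' : c 0 = 0 := (mul_eq_zero.1 hc0).resolve_right hdet0
  have hc1' : c 1 = 0 := (mul_eq_zero.1 hc1).resolve_right hdet0
  rw [hc0', hc1'] at hcc
  have hc2 : c 2 = 1 ∨ c 2 = -1 := by
    have : (c 2 - 1) * (c 2 + 1) = 0 := by nlinarith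
    rcases mul_eq_zero.1 this with h | h
    · exact Or.inl (by linarith)
    · exact Or.inr (by linarith)
  rcases hc2 with h | h
  · left
    ext i
    fin_cases i
    · simpa [e₃] using hc0'
    · simpa [e₃] using hc1'
    · simpa [e₃] using h
  · right
    ext i
    fin_cases i
    · simpa [e₃] using hc0'
    · simpa [e₃] using hc1'
    · simpa [e₃] using h

/-- **TWO LAYERINGS ⇒ PARALLEL AXES OR FCC.**  If a moved Barlow stacking has a second presentation, then the two axes agree up to sign, or the set is
an affine fcc lattice (in the first frame). -/
theorem axis_parallel_or_affineFcc {σ σ' : ℤ → ℤ} (hσ : IsHaggSeq σ) (hσ' : IsHaggSeq σ') {L L' : E3 ≃ₗᵢ[ℝ] E3} {s s' : E3}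
    (h : stacking L s σ = stacking L' s' σ') :
    (L e₃ = L' e₃ ∨ L e₃ = -(L' e₃)) ∨ ∃ A : E3 ≃ₗᵢ[ℝ] E3, stacking L s σ = (fun p => A p + s) '' fccStacking 1 (Real.sqrt (2 / 3)) := by
  by_cases hc : ∀ k, σ k = σ 0
  · obtain ⟨A, -, hA⟩ := exists_affine_fcc_of_const L s hσ hc
    exact Or.inr ⟨A, hA⟩
  left
  obtain ⟨k₁, hk₁⟩ := exists_adjacent_ne_of_not_const hc
  set y₁ : E3 := barlowPos 1 (Real.sqrt (2 / 3)) σ k₁ 0 0 with hy₁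
  have hY : L y₁ + s ∈ stacking L' s' σ' := by rw [← h]; exact ⟨y₁, ⟨k₁, 0, 0, rfl⟩, rfl⟩
  obtain ⟨y₂, hy₂B, hY₂⟩ := hY
  obtain ⟨k₂, i₂, j₂, hy₂⟩ := hy₂B
  set M : E3 ≃ₗᵢ[ℝ] E3 := L.trans L'.symm with hM
  have hMapply : ∀ q, M q = L'.symm (L q) := fun q => rfl
  have hY₂' : L' y₂ = L y₁ + s - s' := by
    have e : L' y₂ + s' = L y₁ + s := hY₂
    rw [← e, add_sub_cancel_right]
  -- every site of `B(σ)` is carried to a site of `B(σ')`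
  have htr : ∀ q ∈ barlowStacking 1 (Real.sqrt (2 / 3)) σ, dist y₁ q = 1 →
      barlowPos 1 (Real.sqrt (2 / 3)) σ' k₂ i₂ j₂ + M (q - y₁) ∈ barlowStacking 1 (Real.sqrt (2 / 3)) σ' := by
    intro q hq _
    have hq' : L q + s ∈ stacking L' s' σ' := by rw [← h]; exact ⟨q, hq, rfl⟩
    obtain ⟨q', hq'B, hq'e⟩ := hq'
    have hq'' : L' q' = L q + s - s' := by
      have e : L' q' + s' = L q + s := hq'e
      rw [← e, add_sub_cancel_right]
    have : barlowPos 1 (Real.sqrt (2 / 3)) σ' k₂ i₂ j₂ + M (q - y₁) = q' := by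
      rw [← hy₂]
      apply L'.injective
      rw [map_add, hMapply, LinearIsometryEquiv.apply_symm_apply, map_sub, hY₂', hq'']
      abel
    rw [this]
    exact hq'B
  obtain ⟨-, hhor⟩ := hcpType_of_shell_transfer hσ hσ' M k₁ 0 0 k₂ i₂ j₂ hk₁ htr
  -- the two in-layer generators go to horizontal vectors
  have hsucc_i := barlowPos_succ_i 1 (Real.sqrt (2 / 3)) σ k₁ 0 0
  have hpred_i := barlowPos_succ_i 1 (Real.sqrt (2 / 3)) σ k₁ (-1) 0
  have hsucc_j := barlowPos_succ_j 1 (Real.sqrt (2 / 3)) σ k₁ 0 0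
  have hpred_j := barlowPos_succ_j 1 (Real.sqrt (2 / 3)) σ k₁ 0 (-1)
  simp only [zero_add, neg_add_cancel] at hsucc_i hpred_i hsucc_j hpred_j
  have hu : (M (triangularVec₁ 1)) 2 = 0 := by
    refine hhor _ norm_triangularVec₁_one ⟨k₁, 1, 0, by rw [hsucc_i]⟩ ⟨k₁, -1, 0, ?_⟩
    rw [hpred_i, add_sub_cancel_right]
  have hv : (M (triangularVec₂ 1)) 2 = 0 := by
    refine hhor _ norm_triangularVec₂_one ⟨k₁, 0, 1, by rw [hsucc_j]⟩ ⟨k₁, 0, -1, ?_⟩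
    rw [hpred_j, add_sub_cancel_right]
  -- hence `M e₃ = ± e₃`, i.e. `L e₃ = ± L' e₃`
  have hLe : L e₃ = L' (M e₃) := by rw [hMapply, LinearIsometryEquiv.apply_symm_apply]
  rcases map_e₃_eq_or_of_horizontal M hu hv with hm | hm
  · exact Or.inl (by rw [hLe, hm])
  · exact Or.inr (by rw [hLe, hm, map_neg])

/-! ### The class frames of a re-presented tent piece -/

namespace TentPiece

/-- **Every class frame of a tent piece whose stacking is an `L₀`-stacking has its lattice inside an `L₀`-stacking.** -/
theorem frame_subset_frameStacking_of_eq (T : TentPiece) {L₀ : E3 ≃ₗᵢ[ℝ] E3} {s₀ : E3} {σ₀ : ℤ → ℤ} (hσ₀ : IsHaggSeq σ₀)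
    (h : stacking T.L T.s T.σ = stacking L₀ s₀ σ₀) (a : ℤ) :
    ∃ (s₁ : E3) (τ : ℤ → ℤ), IsHaggSeq τ ∧ (T.frame a) '' fccRef ⊆ (fun p => L₀ p + s₁) '' barlowStacking 1 (Real.sqrt (2 / 3)) τ := by
  rcases axis_parallel_or_affineFcc T.hσ hσ₀ h with hpar | ⟨A, hA⟩
  · -- PARALLEL: the bilayer `a` of `T` is an `L₀`-bilayer (slab dictionary), so its frame lattice is `L₀ '' Λ₀` or its basal twin
    have hx₀T : s₀ ∈ stacking T.L T.s T.σ := by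
      rw [h]; exact ⟨0, ⟨0, 0, 0, (barlowPos_zero _ _).symm⟩, by simp⟩
    have hx₀ : s₀ ∈ stacking L₀ s₀ σ₀ := ⟨0, ⟨0, 0, 0, (barlowPos_zero _ _).symm⟩, by simp⟩
    have hpar' : L₀ e₃ = T.L e₃ ∨ L₀ e₃ = -(T.L e₃) := by
      rcases hpar with e | e
      · exact Or.inl e.symm
      · exact Or.inr (by rw [e, neg_neg])
    obtain ⟨ε, d, hε, hdict⟩ := exists_height_dictionary hpar' hx₀ hx₀T
    obtain ⟨a', hslab, hbdry⟩ := laySlab_eq_of_dictionary hε hdict a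
    have hbil : bilayer T.L T.s T.σ a = bilayer L₀ s₀ σ₀ a' := by
      ext w
      rw [mem_bilayer_iff_height, mem_bilayer_iff_height, h, hbdry w]
    obtain ⟨u, hu⟩ := T.frame_spec a
    rw [hbil] at hu
    obtain ⟨P, s', hP, hsub⟩ := exists_affine_fcc_supset_bilayer hσ₀ L₀ s₀ a'
    have heq : (T.frame a) '' fccRef = P '' fccRef := image_fccRef_eq_of_bilayer_subset hσ₀ L₀ s₀ a' hu hsub
    rcases hP with rfl | rfl
    · exact ⟨0, constHagg, isHaggSeq_const, by rw [heq, image_fccRef_eq_frameStacking]⟩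
    · exact ⟨0, fun _ => -1, fun _ => Or.inr rfl, by rw [heq, image_basalTwin_fccRef_eq_frameStacking]⟩
  · -- FCC: every bilayer frame has the grain's lattice `A '' Λ₀`, a translate of the stacking itself
    have heq : (T.frame a) '' fccRef = A '' fccRef := bilayerFrame_image_eq T.hσ hA T.framesAt a
    refine ⟨s₀ - T.s, σ₀, hσ₀, ?_⟩
    rw [heq]
    rintro _ ⟨q, hq, rfl⟩
    have hmem : A q + T.s ∈ stacking L₀ s₀ σ₀ := by
      rw [← h, hA]; exact ⟨q, hq, rfl⟩
    obtain ⟨r, hr, hre⟩ := hmem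
    refine ⟨r, hr, ?_⟩
    have e : L₀ r + s₀ = A q + T.s := hre
    show L₀ r + (s₀ - T.s) = A q
    rw [← add_sub_assoc, e, add_sub_cancel_right]

/-- **(L-ax) THE TWO COLUMN GRAINS' CLASS FRAMES SHARE THE RISER AXIS**: two tent pieces whose stackings are `L₀`-stackings have, for every pair of slab
classes, `SharedAxis (L₀ e₃)`. -/
theorem sharedAxis_of_stacking_eq (Tf Tg : TentPiece) {L₀ : E3 ≃ₗᵢ[ℝ] E3} {s₀ s₀' : E3} {σL σR : ℤ → ℤ} (hσL : IsHaggSeq σL) (hσR : IsHaggSeq σR)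
    (hf : stacking Tf.L Tf.s Tf.σ = stacking L₀ s₀ σL) (hg : stacking Tg.L Tg.s Tg.σ = stacking L₀ s₀' σR) (a b : ℤ) :
    SharedAxis (L₀ e₃) (Tf.frame a) (Tg.frame b) := by
  obtain ⟨s₁, τ, hτ, h₁⟩ := Tf.frame_subset_frameStacking_of_eq hσL hf a
  obtain ⟨s₂, τ', hτ', h₂⟩ := Tg.frame_subset_frameStacking_of_eq hσR hg b
  exact ⟨L₀, s₁, s₂, τ, τ', hτ, hτ', rfl, h₁, h₂⟩

end TentPiece

end Summit.Ventures.Crystal3D.Cruxes.TextureLiminf.TexShadow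

end
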